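import Mathlib
import HarnessLib
import Summits.HubbardSuperconductivity.HubbardSuperconductivity.Theorems.KLProgrammeKLRegimeEngineTowerRemeasureUmklappSplit
import Summits.HubbardSuperconductivity.HubbardSuperconductivity.Theorems.KLProgrammeH10TwoPointLimitKlAnisoOffUmklappCountAllScales

/-!
# Route `KLProgramme` — crux K3 ENGINE (stmt-HubbardSuperconductivity-20437 `KLRegimeEngineV17F2`), stub (b) v2, THE LEVELS PACKAGE (ℓ):
# instantiation (I2), THE JUMP HALF — the umklapp split with both counts discharged, ALL SCALES (no threshold `k₀`)
# (continuation of `…EngineTowerRemeasureUmklappSplit`, p591605; p4 g12's all-scales count p591304; cell gate-hubbard-kl, seat hubbard-kl-k3c2-p3 g10)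

`…RemeasureUmklappSplit` keyed the off-class count on p4's `…offUmklapp_klAniso_le_window` (scale threshold `k₀ ≤ k`).  p4's all-scales twin
`PerturbedFermiCurve.card_relCount_prescribed_offUmklapp_klAniso_le_window_allScales` (band constants on `[μ₁−4klE0, μ₂+4klE0]`, every `k ≤ J′`) removes the
threshold; these are the same two corollaries re-keyed on it (consumers prefer them):
* **`klLevNormOf_jump_le_umklappSplit_klEng_allScales m (3 ≤ m)`**, **`klWtPinnedSumAt_jump_le_umklappSplit_klEng_flow_deep_allScales dd m (3 ≤ m)`** — statements
  identical to the `k₀`-versions minus `∃ k₀` / `k₀ ≤ k`.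
Everything is proved; no definitions; nothing about the model is asserted; nothing asserts superconductivity.
References: BGM 2006 §2.8 (2.82)–(2.84), (2.88)–(2.90), App. A3 Lemma A3.1 [cite: BenfattoGiulianiMastropietro2006].
-/

noncomputable section

namespace Summit.HubbardSuperconductivity.HubbardSuperconductivity.Theorems.EngineV8

set_option linter.dupNamespace false -- summit = problem name (single-conjunct summit), D-0017

open Classical
open Real Finset Literature.MathematicalPhysics.QuantumLattice Literature.Probability.LatticeModels GrassmannAlgebra
open Literature.MathematicalPhysics.QuantumLattice.FermiRG
open Summit.HubbardSuperconductivity.HubbardSuperconductivity.Theorems.KLRegimeSplit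
open Summit.HubbardSuperconductivity.HubbardSuperconductivity.Theorems.KLProgrammeLegKernels
open Summit.HubbardSuperconductivity.HubbardSuperconductivity.Theorems.DispersionFlow
open Summit.HubbardSuperconductivity.HubbardSuperconductivity.Theorems.KLRegimeWick
open Summit.HubbardSuperconductivity.HubbardSuperconductivity.Theorems.TorusFourierL2
open Summit.HubbardSuperconductivity.HubbardSuperconductivity.Theorems.PerturbedFermiCurve

variable {L M : ℕ} [NeZero L] [NeZero M]

/-! ## §1 The levelled jump, umklapp split, both counts discharged, ALL SCALES -/

/-- **THE LEVELLED JUMP, UMKLAPP SPLIT, BOTH COUNTS DISCHARGED, NO SCALE THRESHOLD** (as the threshold version, re-keyed on p4's all-scales count).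
[cite: BenfattoGiulianiMastropietro2006, §2.8 (2.82)-(2.84), (2.88)-(2.90), App. A3] -/
theorem klLevNormOf_jump_le_umklappSplit_klEng_allScales (m : ℕ) (hm : 3 ≤ m) :
    ∃ Cm : ℝ, 0 < Cm ∧ ∃ C : ℝ, 0 < C ∧ ∃ D₁ : ℝ, 0 < D₁ ∧ ∃ D₂ : ℝ, 0 < D₂ ∧
      ∀ R : RenConsts, R.WF2 → ∃ c₃ : ℝ, 0 < c₃ ∧ ∃ U₀ : ℝ, 0 < U₀ ∧
      ∀ (P : SplitConsts) (c : ℝ), P.WF → 0 < c → c ≤ klEngC₃6 P R → c ≤ c₃ →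
      ∀ μ ∈ klWindowC, ∀ U : ℝ, 0 < U → U ≤ klEngU₀9 P R c → U ≤ U₀ → ∀ β : ℝ, klBetaMin ≤ β → β ≤ Real.exp (c / U ^ 2) →
      ∀ K : TrigPolyC4v, FrameOK R U (nScales β) μ K → ∀ (L M : ℕ) [NeZero L] [NeZero M],
      klEngL₃ β U ≤ L → klEngM₃ β U L ≤ M → ∀ k J' : ℕ, k + 1 ≤ J' → J' ≤ nScales β + 1 →
      ∀ T : HubbardGrassmann L M,
        (∀ (m' : ℕ) (X : Fin m' → HubbardFieldIdx L M), ∑ i, signedMomentum L (X i).2 (X i).1.1.2 ≠ 0 → kernel ℂ T m' X = 0) →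
      ∀ (Ωe : Fin (m + 1) → Option (SectorLeg (sectorCount J'))) (N NB : ℝ), 0 ≤ N → 0 ≤ NB →
        (∀ Ωe' : Fin (m + 1) → Option (SectorLeg (sectorCount k)), levelCount Ωe' = levelCount Ωe →
          klLevNormOf L M β μ K k (m + 1) T Ωe' ≤ N) →
        (∀ Ωe' : Fin (m + 1) → Option (SectorLeg (sectorCount k)), levelCount Ωe' = levelCount Ωe →
          hubbardSectorKernelNorm L M β (klAnisoFamily L M β μ K klE0 k)
            (prescribedTuples (univ.filter fun σ' : Fin (m + 1) → SectorLeg (sectorCount k) =>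
              ¬ ∀ G : Fin 2 → ℤ, G ≠ 0 → ∃ j : Fin 2, ((m : ℝ) + 1) * C * sectorWidth k <
                |∑ i, (if (σ' i).2 = 0 then klFermiPoint μ K (sectorCenter k (σ' i).1.1) j
                    else -klFermiPoint μ K (sectorCenter k (σ' i).1.1) j) - 2 * π * (G j : ℝ)|) Ωe') T ≤ NB) →
        klLevNormOf L M β μ K J' (m + 1) T Ωe ≤
          Cm * ((27 : ℝ) ^ (levelCount Ωe + 1) * D₁ ^ (m + 1) * ((2 : ℝ) ^ (J' - k)) ^ (m - 2) * N +
            D₂ * 27 ^ (m + 1) * ((2 : ℝ) ^ (J' - k)) ^ (m - levelCount Ωe) * NB) := by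
  obtain ⟨CJ, hCJ, hov⟩ := overlap_jump_sums_klEng
  obtain ⟨C, hC, D₁, hD₁, hoff⟩ := card_relCount_prescribed_offUmklapp_klAniso_le_window_allScales
  obtain ⟨D₂, hD₂, hon⟩ := card_relCount_prescribed_lastLeg_klAniso_le_window m
  refine ⟨(3 * CJ / 2) ^ (m + 1), by positivity, C, hC, D₁, hD₁, D₂, hD₂, fun R hR2 => ?_⟩
  have hRj : ∀ j, 0 ≤ R.Gfr j := gfr_nonneg_of_wf2 hR2
  obtain ⟨c₃, hc₃, U₀, hU₀, hoff'⟩ := hoff R hRj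
  obtain ⟨c₃', hc₃', U₀', hU₀', hon'⟩ := hon R hRj
  refine ⟨min c₃ c₃', lt_min hc₃ hc₃', min U₀ U₀', lt_min hU₀ hU₀', ?_⟩
  intro P c hP hc hc6 hcm μ hμ U hU hU9 hUm β hβmin hβc K hK L M _ _ hL3 hM3 k J' hJ hJN T hT Ωe N NB hN0 hNB0 hN hNB
  have hβ : 0 < β := KLRegimeSplit.pos_of_klBetaMin_le hβmin
  have hkJ : k ≤ J' := by omega
  obtain ⟨_, hcol₁, hrow₁⟩ := hov P R c hP hR2 hc hc6 μ hμ U hU hU9 β hβmin hβc K hK L M hL3 hM3 k J' hJ hJN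
  have hc₁0 : (0 : ℝ) ≤ 3 * CJ * M / β := by positivity
  set B : Finset (Fin (m + 1) → SectorLeg (sectorCount k)) := univ.filter fun σ' : Fin (m + 1) → SectorLeg (sectorCount k) =>
    ¬ ∀ G : Fin 2 → ℤ, G ≠ 0 → ∃ j : Fin 2, ((m : ℝ) + 1) * C * sectorWidth k <
      |∑ i, (if (σ' i).2 = 0 then klFermiPoint μ K (sectorCenter k (σ' i).1.1) j
          else -klFermiPoint μ K (sectorCenter k (σ' i).1.1) j) - 2 * π * (G j : ℝ)| with hB
  have hA₁ : (0 : ℝ) ≤ (27 : ℝ) ^ (levelCount Ωe + 1) * D₁ ^ (m + 1) * ((2 : ℝ) ^ (J' - k)) ^ (m - 2) := by positivity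
  have hA₂ : (0 : ℝ) ≤ D₂ * 27 ^ (m + 1) * ((2 : ℝ) ^ (J' - k)) ^ (m - levelCount Ωe) := by positivity
  have h := klLevNormOf_jump_le_split_of_consts_pinned hβ μ K hJ T hT hc₁0 hc₁0 hcol₁ hrow₁ m B Ωe hA₁ hA₂ hN0 hNB0
    (fun E τ'' σ' p hp hσ' hFE hEF => ?_) (fun E τ'' σ' p hp _ hFE hEF => ?_) hN hNB
  · have hMne : (M : ℝ) ≠ 0 := by exact_mod_cast NeZero.ne M
    have hεc : imagTimeWeight β M * (3 * CJ * M / β) = 3 * CJ / 2 := by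
      unfold imagTimeWeight; field_simp
    have hconst : (3 * CJ * M / β) ^ m * (3 * CJ * M / β) * imagTimeWeight β M ^ (m + 1) = (3 * CJ / 2) ^ (m + 1) := by
      rw [← pow_succ, ← mul_pow, mul_comm (3 * CJ * M / β), hεc]
    calc klLevNormOf L M β μ K J' (m + 1) T Ωe
        ≤ (3 * CJ * M / β) ^ m * (3 * CJ * M / β) * imagTimeWeight β M ^ (m + 1) *
            ((27 : ℝ) ^ (levelCount Ωe + 1) * D₁ ^ (m + 1) * ((2 : ℝ) ^ (J' - k)) ^ (m - 2) * N +
              D₂ * 27 ^ (m + 1) * ((2 : ℝ) ^ (J' - k)) ^ (m - levelCount Ωe) * NB) := h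
      _ = (3 * CJ / 2) ^ (m + 1) * ((27 : ℝ) ^ (levelCount Ωe + 1) * D₁ ^ (m + 1) * ((2 : ℝ) ^ (J' - k)) ^ (m - 2) * N +
              D₂ * 27 ^ (m + 1) * ((2 : ℝ) ^ (J' - k)) ^ (m - levelCount Ωe) * NB) := by rw [hconst]
  · -- off the class: the second-determined-leg count
    have hoffσ : ∀ G : Fin 2 → ℤ, G ≠ 0 → ∃ j : Fin 2, ((m : ℝ) + 1) * C * sectorWidth k <
        |∑ i, (if (σ' i).2 = 0 then klFermiPoint μ K (sectorCenter k (σ' i).1.1) j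
            else -klFermiPoint μ K (sectorCenter k (σ' i).1.1) j) - 2 * π * (G j : ℝ)| := by
      by_contra hno
      exact hσ' (by simp only [hB, mem_filter, mem_univ, true_and]; exact hno)
    have hcnt := hoff' c hc (hcm.trans (min_le_left _ _)) U hU (hUm.trans (min_le_left _ _)) β hβmin hβc μ hμ μ K hK L M m k J' hkJ hm
      _ subset_rfl E τ'' p hp σ' hoffσ
    exact (mul_le_mul_of_nonneg_left hcnt (by positivity)).trans (offClass_count_arith hD₁.le (J' - k) m (levelCount Ωe) E.card (by omega) hEF)
  · -- on the class: the one-determined-leg count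
    have hcnt := hon' c hc (hcm.trans (min_le_right _ _)) U hU (hUm.trans (min_le_right _ _)) β hβmin hβc μ hμ μ K hK L M k J' hkJ _ subset_rfl E τ'' σ'
    exact (mul_le_mul_of_nonneg_left hcnt (by positivity)).trans
      (legSet_count_arith hD₂.le (J' - k) m (levelCount Ωe) E.card hFE ((card_le_univ _).trans_eq (Fintype.card_fin _)))

/-! ## §2 The weighted jump at the flow frame, umklapp split, both counts discharged, ALL SCALES -/

/-- **THE WEIGHTED JUMP AT THE FLOW FRAME (deep window), UMKLAPP SPLIT, BOTH COUNTS DISCHARGED, NO SCALE THRESHOLD** (every rate `j ≥ J′`).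
[cite: BenfattoGiulianiMastropietro2006, §2.8 (2.82)-(2.84), (2.88)-(2.90), App. A3] -/
theorem klWtPinnedSumAt_jump_le_umklappSplit_klEng_flow_deep_allScales (dd m : ℕ) (hm : 3 ≤ m) :
    ∃ Cm : ℝ, 0 < Cm ∧ ∃ C : ℝ, 0 < C ∧ ∃ D₁ : ℝ, 0 < D₁ ∧ ∃ D₂ : ℝ, 0 < D₂ ∧
      ∀ R : RenConsts, R.WF2 → ∃ c₃ : ℝ, 0 < c₃ ∧ ∃ U₀ : ℝ, 0 < U₀ ∧
      ∀ (G : GeoConsts) (P : SplitConsts) (Q : EngConsts) (cc : ℝ), 0 < cc → cc ≤ klEngC₃6 P R → cc ≤ c₃ →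
      ∀ μ ∈ klWindowC, ∀ U : ℝ, 0 < U → U ≤ min (klEngU₀3 P R cc) (1 / (R.Gfr 3 + 1)) → U ≤ U₀ →
      ∀ β : ℝ, klBetaMin ≤ β → β ≤ Real.exp (cc / U ^ 2) →
      ∀ (L M : ℕ) [NeZero L] [NeZero M], klEngL₃ β U ≤ L → klEngM₃ β U L ≤ M →
      ∀ n : ℕ, 1 ≤ n → n ≤ nScales β + 1 →
        HistP klPredsV17F2 L M G P Q R β U μ 0 n → FrameOK R U (nScales β) μ (klFlowFrameU L M β U μ n) →
        ∀ k J' : ℕ, k + 1 ≤ J' → J' ≤ n → (4 : ℝ) ^ n * U ≤ (4 : ℝ) ^ (2 * (k + 1) + dd) →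
        ∀ T : HubbardGrassmann L M,
          (∀ (m' : ℕ) (X : Fin m' → HubbardFieldIdx L M), ∑ i, signedMomentum L (X i).2 (X i).1.1.2 ≠ 0 → kernel ℂ T m' X = 0) →
        ∀ j : ℕ, J' ≤ j → ∀ (q : Fin (m + 1)) (w : SpaceTimeIdx L M × SectorLeg (sectorCount J')) (N NB : ℝ), 0 ≤ N → 0 ≤ NB →
          (∀ w' : SpaceTimeIdx L M × SectorLeg (sectorCount k),
            klWtPinnedSumAt L M β μ (klFlowFrameU L M β U μ n) k j (m + 1) T q w' ≤ N) →
          (∀ (ℓ' : SectorLeg (sectorCount k)) (y' : SpaceTimeIdx L M),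
            imagTimeWeight β M ^ m *
              ∑ σ' ∈ (univ.filter fun σ' : Fin (m + 1) → SectorLeg (sectorCount k) =>
                  ¬ ∀ G : Fin 2 → ℤ, G ≠ 0 → ∃ j : Fin 2, ((m : ℝ) + 1) * C * sectorWidth k <
                    |∑ i, (if (σ' i).2 = 0 then klFermiPoint μ (klFlowFrameU L M β U μ n) (sectorCenter k (σ' i).1.1) j
                        else -klFermiPoint μ (klFlowFrameU L M β U μ n) (sectorCenter k (σ' i).1.1) j) - 2 * π * (G j : ℝ)|).filter
                (fun σ' : Fin (m + 1) → SectorLeg (sectorCount k) => σ' q = ℓ'),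
              ∑ x' ∈ univ.filter (fun x' : Fin (m + 1) → SpaceTimeIdx L M => x' q = y'),
                klScaleWt L M β j ((univ.image x').image (fun x : SpaceTimeIdx L M => (((((2 * (x.1 : ℕ) : ℕ)) : ZMod (2 * (2 * M)))), x.2))) *
                  ‖sectorisedKernel L M β (klAnisoFamily L M β μ (klFlowFrameU L M β U μ n) klE0 k) T (m + 1) σ' x'‖ ≤ NB) →
          klWtPinnedSumAt L M β μ (klFlowFrameU L M β U μ n) J' j (m + 1) T q w ≤
            Cm * ((27 : ℝ) * D₁ ^ (m + 1) * ((2 : ℝ) ^ (J' - k)) ^ (m - 2) * N + D₂ * 27 ^ (m + 1) * ((2 : ℝ) ^ (J' - k)) ^ (m - 1) * NB) := by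
  obtain ⟨Cm, hCm, hsplit⟩ := klWtPinnedSumAt_jump_le_split_klEng_flow_deep dd m
  obtain ⟨C, hC, D₁, hD₁, hoff⟩ := card_relCount_prescribed_offUmklapp_klAniso_le_window_allScales
  obtain ⟨D₂, hD₂, hon⟩ := card_relCount_prescribed_lastLeg_klAniso_le_window m
  refine ⟨Cm, hCm, C, hC, D₁, hD₁, D₂, hD₂, fun R hR2 => ?_⟩
  have hRj : ∀ j, 0 ≤ R.Gfr j := gfr_nonneg_of_wf2 hR2
  obtain ⟨c₃, hc₃, U₀, hU₀, hoff'⟩ := hoff R hRj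
  obtain ⟨c₃', hc₃', U₀', hU₀', hon'⟩ := hon R hRj
  refine ⟨min c₃ c₃', lt_min hc₃ hc₃', min U₀ U₀', lt_min hU₀ hU₀', ?_⟩
  intro G P Q cc hcc hcc6 hccm μ hμ U hU hUle hUm β hβmin hβc L M _ _ hL3 hM3 n hn1 hnN hhist hfr k J' hJ hJn hwin T hT j hjJ q w N NB hN0 hNB0
    hN hNB
  have hkJ : k ≤ J' := by omega
  set K : TrigPolyC4v := klFlowFrameU L M β U μ n with hK
  set B : Finset (Fin (m + 1) → SectorLeg (sectorCount k)) := univ.filter fun σ' : Fin (m + 1) → SectorLeg (sectorCount k) =>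
    ¬ ∀ G : Fin 2 → ℤ, G ≠ 0 → ∃ j : Fin 2, ((m : ℝ) + 1) * C * sectorWidth k <
      |∑ i, (if (σ' i).2 = 0 then klFermiPoint μ K (sectorCenter k (σ' i).1.1) j
          else -klFermiPoint μ K (sectorCenter k (σ' i).1.1) j) - 2 * π * (G j : ℝ)| with hB
  have hA₁ : (0 : ℝ) ≤ (27 : ℝ) * D₁ ^ (m + 1) * ((2 : ℝ) ^ (J' - k)) ^ (m - 2) := by positivity
  have hA₂ : (0 : ℝ) ≤ D₂ * 27 ^ (m + 1) * ((2 : ℝ) ^ (J' - k)) ^ (m - 1) := by positivity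
  refine hsplit G P R Q cc hR2 hcc hcc6 μ hμ U hU hUle β hβmin hβc L M hL3 hM3 n hn1 hnN hhist hfr k J' hJ hJn hwin T hT j hjJ B q w _ _ N NB
    hA₁ hA₂ hN0 hNB0 (fun ℓ'' σ' hσ' => ?_) (fun ℓ'' σ' _ => ?_) hN hNB
  · have hoffσ : ∀ G : Fin 2 → ℤ, G ≠ 0 → ∃ j : Fin 2, ((m : ℝ) + 1) * C * sectorWidth k <
        |∑ i, (if (σ' i).2 = 0 then klFermiPoint μ K (sectorCenter k (σ' i).1.1) j
            else -klFermiPoint μ K (sectorCenter k (σ' i).1.1) j) - 2 * π * (G j : ℝ)| := by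
      by_contra hno
      exact hσ' (by simp only [hB, mem_filter, mem_univ, true_and]; exact hno)
    have hcnt := hoff' cc hcc (hccm.trans (min_le_left _ _)) U hU (hUm.trans (min_le_left _ _)) β hβmin hβc μ hμ μ K hfr L M m k J' hkJ hm
      _ subset_rfl ({q} : Finset (Fin (m + 1))) (fun _ => ℓ'') q (mem_singleton_self _) σ' hoffσ
    have h1 := offClass_count_arith hD₁.le (J' - k) m 0 1 (by omega) (by omega)
    simp only [pow_one, zero_add] at h1
    exact (mul_le_mul_of_nonneg_left hcnt (by norm_num)).trans h1
  · have hcnt := hon' cc hcc (hccm.trans (min_le_right _ _)) U hU (hUm.trans (min_le_right _ _)) β hβmin hβc μ hμ μ K hfr L M k J' hkJ _ subset_rfl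
      ({q} : Finset (Fin (m + 1))) (fun _ => ℓ'') σ'
    have h1 := legSet_count_arith hD₂.le (J' - k) m 1 1 le_rfl (by omega)
    rw [card_singleton] at hcnt
    rw [pow_one] at h1
    exact (mul_le_mul_of_nonneg_left hcnt (by norm_num)).trans h1

end Summit.HubbardSuperconductivity.HubbardSuperconductivity.Theorems.EngineV8

end
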